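import Literature.MathematicalPhysics.QuantumFieldTheory.Balaban1983to89.B9Thm31SiteGpBoundsReg335Y
import Literature.MathematicalPhysics.QuantumFieldTheory.Balaban1983to89.B9Thm37CubeCoverCommutatorSizes

/-!
# `Balaban1983to89.B9Thm31SitePolarisedFormY` — T. Bałaban, *Propagators for lattice gauge theories in a background field*, Commun. Math. Phys.
# **99** (1985) 389–434 [Balaban1985BackgroundPropagators] (3.24) p. 394 ∕ Thm 3.1 (3.46) p. 398: ★ **(3.24) POLARISED AT def-Y's LETTERS** —
# `⟨Ψ, Δ′_a(U)Φ⟩₁ = Σ_μ⟨∇_{U,μ}Ψ, ∇_{U,μ}Φ⟩₁ + Σ_zΣ_w a(z,w)·Re tr((X^Ψ_z)ᴴX^Φ_w)`, the fibre algebra of `Re tr(AᴴB)` and the row sums of the averaging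
# coefficient (file 5a of the site-coercivity set of width seat `pub-ymgap-dag-n06-w1`; the input of file 5b's conjugation identity — Agmon's method for (3.46))

statement-level skeleton of published theorems with citation tags; proofs where landed; nothing here is a claim about the Yang–Mills mass gap

THE PRINT.  (3.24) p. 394: *«⟨λ, Q′\*aQ′λ⟩ = Σ_j a_j Σ_{y∈Λ_j}(Lʲη)^{d−2}|(Q′_j(U)λ)(y)|²»*, `Δ′_a(U) = Δ^η_U + Q′\*aQ′`; Thm 3.1 (3.46) p. 398: *«we have the
inequalities in L₂-norms ‖hG′(U)λ‖, … ≤ B₀(Lʲη)(Lʲ′η)e^{−δ₀d(y,y′)}‖h‖‖λ‖»*.  dag-n06-j's `B9Thm311DeltaPrimePos.trIP_deltaPrimeAY_eq` is the DIAGONAL of (3.24)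
at def-Y's letter (`⟨Φ, Δ′_a(U)Φ⟩₁` as a sum of squares); the positive-weight (Agmon ∕ Combes–Thomas) treatment of (3.46) in files 5b–7 needs the
POLARISED form `⟨Ψ, Δ′_a(U)Φ⟩₁`, typed here once.

WHAT THIS FILE PROVES (sorry-free; 0 `def`; `G`-valued background and table, `G ≤ U(N)`, NO smallness; nothing of [B9] asserted).  Notation of the
docstrings: `X^Φ_z := R(U(Γ_{c_z,z}))Φ(z)` (`crnTrY`), `a(z,w) := avgCoeffY i z w` (= `levC_{lev z}·[z ∼ w]`), `q(s,t) := s∕t + t∕s − 2`, `m_z := ((L^{lev z})²)⁻¹`.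
* §1 fibre algebra of `Re tr(AᴴB)`: `re_trace_ofReal_smul_left ∕ _right`, `re_trace_sub_left ∕ _right`, ★ `re_trace_smul_sub_smul`
  (`Re tr((sA − tB)ᴴ(s′A − t′B)) = ss′HS(A) + tt′HS(B) − (st′ + ts′)Re tr(AᴴB)`), ★ `abs_re_trace_le_half_add` (`|Re tr(AᴴB)| ≤ ½(HS A + HS B)`),
  `q_nonneg`, `q_comm`.
* §2 the averaging coefficient: ★ `sum_avgCoeffY_le` (`Σ_w a(z,w) ≤ m_z`: `levC_j·n_j^{d+1} = a_j·n_j⁻² ≤ n_j⁻²`; sharper than the tree's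
  `B9Thm37CubeCoverCommutatorSizes.sum_abs_avgCoeffY_le_one`, whose `avgCoeffY_nonneg` is imported).
* §3 ★ `avgCoeffY_mul_re_trace_eq₂` (two-field twin of dag-n06-j's corner-frame lemma), ★★ `trIP_deltaPrimeAY_bilin` ((3.24) POLARISED).
HONEST SCOPE.  Bookkeeping identities for one finite lattice operator; NOT a node discharge, NOT summit progress; count-neutral; nothing continuum ∕ OS ∕
mass gap ∕ Clay.  NEW file importing file 4 (`B9Thm31SiteGpBoundsReg335Y`) and `B9Thm37CubeCoverCommutatorSizes` (for `avgCoeffY_nonneg`) only; nothing landed is modified.  Net new unproved facts: 0.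
-/

noncomputable section

namespace Literature.MathematicalPhysics.QuantumFieldTheory.Balaban1983to89.B9Thm31SitePolarisedFormY

open Literature.MathematicalPhysics.QuantumFieldTheory.Balaban1983to89
open Node00 B6KLevelCensusIndexV1 B6Geom246MultiLevelBox B6MultiLevelBoxOperator B6MultiLevelTorusOperator B6GlobalChartV1 B9BackgroundsKLevelV1
  B9Eq39Adjoint B9Thm311ReadingCoords B9Thm311DeltaPrimePos B9Ineq369CurvatureSmallAtLettersY B9Thm31SiteCoerciveGaugeBlockY
  B9Thm31SiteCoerciveReg335Y B9Thm31SiteGpBoundsReg335Y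
open Literature.MathematicalPhysics.QuantumFieldTheory.Balaban1983to89.B9Ineq349SiteAdjoint (trIP_comm)
open Literature.MathematicalPhysics.QuantumFieldTheory.Balaban1983to89.B9Thm311DeltaPrimeSymm (trIP_one_eq sum_trace_mul_lapS avgCoeffY_eq_ite avgCoeffY_symm
  cornerY_levY_eq re_trace_conjTranspose_mul_comm)
open Literature.MathematicalPhysics.QuantumFieldTheory.Balaban1983to89.B9Thm311AdjointAtLetters (trace_conjTranspose_R_mul re_trace_conjTranspose_mul_trLiftY)
open Literature.MathematicalPhysics.QuantumFieldTheory.Balaban1983to89.B4Lower18 (card_filter_rblk)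
open Literature.MathematicalPhysics.QuantumFieldTheory.Balaban1983to89.B9Thm37CubeCoverCommutatorSizes (avgCoeffY_nonneg)
open scoped Matrix Matrix.Norms.L2Operator

/-! ## §1 Fibre algebra of `Re tr(AᴴB)`; the defect coefficient `q(s,t) = s∕t + t∕s − 2` -/

section Fibre

variable {N : ℕ}

/-- real scalars in the left slot: `Re tr((sA)ᴴB) = s·Re tr(AᴴB)`. [cite: Balaban1985BackgroundPropagators, p.392 (X·Y = tr XY), bookkeeping] -/
theorem re_trace_ofReal_smul_left (s : ℝ) (A B : Matrix (Fin N) (Fin N) ℂ) :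
    (Matrix.trace ((((s : ℂ)) • A)ᴴ * B)).re = s * (Matrix.trace (Aᴴ * B)).re := by
  rw [Matrix.conjTranspose_smul, Complex.star_def, Complex.conj_ofReal, Matrix.smul_mul, Matrix.trace_smul, smul_eq_mul, Complex.re_ofReal_mul]

/-- real scalars in the right slot: `Re tr(Aᴴ(sB)) = s·Re tr(AᴴB)`. [cite: Balaban1985BackgroundPropagators, p.392 (X·Y = tr XY), bookkeeping] -/
theorem re_trace_ofReal_smul_right (s : ℝ) (A B : Matrix (Fin N) (Fin N) ℂ) :
    (Matrix.trace (Aᴴ * ((s : ℂ) • B))).re = s * (Matrix.trace (Aᴴ * B)).re := by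
  rw [Matrix.mul_smul, Matrix.trace_smul, smul_eq_mul, Complex.re_ofReal_mul]

/-- differences in the left slot. [cite: Balaban1985BackgroundPropagators, p.392, bookkeeping] -/
theorem re_trace_sub_left (A A' B : Matrix (Fin N) (Fin N) ℂ) :
    (Matrix.trace ((A - A')ᴴ * B)).re = (Matrix.trace (Aᴴ * B)).re - (Matrix.trace (A'ᴴ * B)).re := by
  rw [Matrix.conjTranspose_sub, Matrix.sub_mul, Matrix.trace_sub, Complex.sub_re]

/-- differences in the right slot. [cite: Balaban1985BackgroundPropagators, p.392, bookkeeping] -/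
theorem re_trace_sub_right (A B B' : Matrix (Fin N) (Fin N) ℂ) :
    (Matrix.trace (Aᴴ * (B - B'))).re = (Matrix.trace (Aᴴ * B)).re - (Matrix.trace (Aᴴ * B')).re := by
  rw [Matrix.mul_sub, Matrix.trace_sub, Complex.sub_re]

/-- ★ THE CONJUGATED DIFFERENCE PAIRING: `Re tr((sA − tB)ᴴ(s′A − t′B)) = ss′·HS(A) + tt′·HS(B) − (st′ + ts′)·Re tr(AᴴB)` for real `s, t, s′, t′`.
[cite: Agmon1982, Ch.1 (the conjugated form); Balaban1985BackgroundPropagators, (3.23)–(3.24) p.394] -/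
theorem re_trace_smul_sub_smul (s t s' t' : ℝ) (A B : Matrix (Fin N) (Fin N) ℂ) :
    (Matrix.trace ((((s : ℂ)) • A - ((t : ℂ)) • B)ᴴ * (((s' : ℂ)) • A - ((t' : ℂ)) • B))).re
      = s * s' * (Matrix.trace (Aᴴ * A)).re + t * t' * (Matrix.trace (Bᴴ * B)).re - (s * t' + t * s') * (Matrix.trace (Aᴴ * B)).re := by
  rw [re_trace_sub_left, re_trace_sub_right, re_trace_sub_right, re_trace_ofReal_smul_left, re_trace_ofReal_smul_left, re_trace_ofReal_smul_left,
    re_trace_ofReal_smul_left, re_trace_ofReal_smul_right, re_trace_ofReal_smul_right, re_trace_ofReal_smul_right, re_trace_ofReal_smul_right,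
    re_trace_conjTranspose_mul_comm A B]
  ring

/-- ★ `|Re tr(AᴴB)| ≤ ½(HS(A) + HS(B))` (Cauchy–Schwarz and AM–GM). [cite: Balaban1985Averaging, (17)–(20) pp.20–21, bookkeeping] -/
theorem abs_re_trace_le_half_add (A B : Matrix (Fin N) (Fin N) ℂ) :
    |(Matrix.trace (Aᴴ * B)).re| ≤ (1 / 2 : ℝ) * (∑ a, ∑ b, ‖A a b‖ ^ 2 + ∑ a, ∑ b, ‖B a b‖ ^ 2) := by
  have h := abs_re_trace_le A B
  have ha := hs_nonneg A
  have hb := hs_nonneg B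
  nlinarith [sq_nonneg (Real.sqrt (∑ a, ∑ b, ‖A a b‖ ^ 2) - Real.sqrt (∑ a, ∑ b, ‖B a b‖ ^ 2)), Real.sq_sqrt ha, Real.sq_sqrt hb,
    Real.sqrt_nonneg (∑ a, ∑ b, ‖A a b‖ ^ 2), Real.sqrt_nonneg (∑ a, ∑ b, ‖B a b‖ ^ 2)]

/-- the defect coefficient `q(s,t) = s∕t + t∕s − 2 = (s − t)²∕(st)` is NONNEGATIVE for `s, t > 0`. [cite: Agmon1982, Ch.1, bookkeeping] -/
theorem q_nonneg {s t : ℝ} (hs : 0 < s) (ht : 0 < t) : 0 ≤ s / t + t / s - 2 := by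
  have e : s / t + t / s - 2 = (s - t) ^ 2 / (s * t) := by field_simp; ring
  rw [e]; positivity

/-- `q` is symmetric. [cite: Agmon1982, Ch.1, bookkeeping] -/
theorem q_comm (s t : ℝ) : s / t + t / s - 2 = t / s + s / t - 2 := by ring

end Fibre

/-! ## §2 The averaging coefficient: nonnegative, row sums at most the local mass `(L^{lev})⁻²` -/

section Coeff

variable {d ℓ : ℕ} {hd : 1 ≤ d + 1} {hL : Odd (ℓ + 1) ∧ 1 < ℓ + 1} {b₀ b₁ : ℝ}
variable (i : KIdx d ℓ hd hL b₀ b₁)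

/-- ★ THE ROW SUM OF THE AVERAGING COEFFICIENT IS AT MOST THE LOCAL MASS: `Σ_w a(z,w) = levC_{j}·n_j^{d+1} = a_j·n_j⁻² ≤ (L^{lev z})⁻²` (`a_j ≤ 1`).
[cite: Balaban1984PropagatorsII, (2.14) p.225; Balaban1985BackgroundPropagators, (3.24) p.394] -/
theorem sum_avgCoeffY_le (z : SiteY i) :
    ∑ w, avgCoeffY i z w ≤ (((((ℓ + 1) ^ (blkOf i.D.toDomains z).1.1 : ℕ) : ℝ)) ^ 2)⁻¹ := by
  set s := blkOf i.D.toDomains z with hs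
  have hlev : levY i z = s.1.1 := by
    change i.D.toDomains.lev z.1 = _
    exact lev_eq_of_blkOf_eq i.D.toDomains hs.symm
  have hsum : ∑ w, avgCoeffY i z w = levC d ℓ (aPrinted ℓ 1) s.1.1 * ((Finset.univ.filter (fun w : SiteY i => blkOf i.D.toDomains w = s)).card : ℝ) := by
    simp_rw [avgCoeffY_eq_ite, hlev]
    rw [← Finset.sum_filter, Finset.sum_const, nsmul_eq_mul, mul_comm]
  have hcard : ((Finset.univ.filter (fun w : SiteY i => blkOf i.D.toDomains w = s)).card : ℝ) = (((ℓ + 1) ^ s.1.1 : ℕ) : ℝ) ^ (d + 1) := by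
    rw [← filter_rblk_eq_filter_blkOf i s,
      card_filter_rblk (le_trans one_le_two (two_le_side i s)) (isBlockUnion_XB i (scale_bounds i.D.toDomains s).2)]
    push_cast; ring
  rw [hsum, hcard, levC_mul_side_pow i s]
  have ha1 : aPrinted ℓ 1 s.1.1 ≤ 1 := B6Prop23KLevelTorusCensus.aPrinted_le_one (by have := i.hℓ; omega) _ (one_le_level i s)
  have hinv0 : 0 ≤ ((((ℓ + 1) ^ s.1.1 : ℕ) : ℝ) ^ 2)⁻¹ := inv_nonneg.2 (by positivity)
  calc aPrinted ℓ 1 s.1.1 * ((((ℓ + 1) ^ s.1.1 : ℕ) : ℝ) ^ 2)⁻¹ ≤ 1 * ((((ℓ + 1) ^ s.1.1 : ℕ) : ℝ) ^ 2)⁻¹ := mul_le_mul_of_nonneg_right ha1 hinv0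
    _ = _ := one_mul _

end Coeff

/-! ## §3 (3.24) polarised -/

section Bilinear

variable {d ℓ : ℕ} {hd : 1 ≤ d + 1} {hL : Odd (ℓ + 1) ∧ 1 < ℓ + 1} {b₀ b₁ : ℝ}
variable (i : KIdx d ℓ hd hL b₀ b₁) {N : ℕ} {G : Subgroup (Matrix (Fin N) (Fin N) ℂ)ˣ}

/-- ★ ONE TERM OF THE POLARISED AVERAGING FORM on an inverse-symmetric `G`-valued table, `G ≤ U(N)`:
`a(z,w)·Re tr(Ψ(z)ᴴ R(U(Γ_{z,c})U(Γ_{c,w}))Φ(w)) = a(z,w)·Re tr((R(U(Γ_{c,z}))Ψ(z))ᴴ R(U(Γ_{c,w}))Φ(w))` (two-field twin of dag-n06-j's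
`avgCoeffY_mul_re_trace_eq`). [cite: Balaban1985BackgroundPropagators, (3.19) p.393, (3.24) p.394] -/
theorem avgCoeffY_mul_re_trace_eq₂ (hG : G ≤ B7Prop2Explicit.unitaryUnits (Matrix (Fin N) (Fin N) ℂ))
    (par : SiteParY (Matrix (Fin N) (Fin N) ℂ) i) (U : CfgY (Matrix (Fin N) (Fin N) ℂ) i) (hinv : ∀ z z' : SiteY i, par U z z' = (par U z' z)⁻¹)
    (hpar : ∀ z w : SiteY i, par U z w ∈ G) (Ψ Φ : SiteY i → Matrix (Fin N) (Fin N) ℂ) (z w : SiteY i) :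
    avgCoeffY i z w * (Matrix.trace ((Ψ z)ᴴ * R (avgTrY i par U z w) (Φ w))).re
      = avgCoeffY i z w * (Matrix.trace ((crnTrY i par U Ψ z)ᴴ * crnTrY i par U Φ w)).re := by
  by_cases h0 : avgCoeffY i z w = 0
  · rw [h0, zero_mul, zero_mul]
  · have hc : blkOf i.D.toDomains w = blkOf i.D.toDomains z := by
      rw [avgCoeffY_eq_ite] at h0; by_contra hne; exact h0 (if_neg hne)
    simp only [crnTrY]
    rw [hc, avgTrY, cornerY_levY_eq i z, hinv z (blkCornerY i (blkOf i.D.toDomains z)), B9Eq39Adjoint.R_mul,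
      ← trace_conjTranspose_R_mul (par U (blkCornerY i (blkOf i.D.toDomains z)) z) (hG (hpar _ _))]

/-- ★★ **(3.24) POLARISED AT def-Y's LETTER**: `⟨Ψ, Δ′_a(U)Φ⟩₁ = Σ_μ ⟨∇_{U,μ}Ψ, ∇_{U,μ}Φ⟩₁ + Σ_zΣ_w a(z,w)·Re tr((X^Ψ_z)ᴴ X^Φ_w)` on an inverse-symmetric
`G`-valued table at a `G`-valued background, `G ≤ U(N)`. [cite: Balaban1985BackgroundPropagators, (3.23)–(3.24) pp.394–395] -/
theorem trIP_deltaPrimeAY_bilin (hG : G ≤ B7Prop2Explicit.unitaryUnits (Matrix (Fin N) (Fin N) ℂ))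
    (par : SiteParY (Matrix (Fin N) (Fin N) ℂ) i) (U : CfgY (Matrix (Fin N) (Fin N) ℂ) i) (hinv : ∀ z z' : SiteY i, par U z z' = (par U z' z)⁻¹)
    (hpar : ∀ z w : SiteY i, par U z w ∈ G) (hU : ∀ μ x, U μ x ∈ G) (Ψ Φ : SiteY i → Matrix (Fin N) (Fin N) ℂ) :
    trIP (fun _ => (1 : ℝ)) Ψ (deltaPrimeAY i par U Φ)
      = (∑ μ : Fin (d + 1), trIP (fun _ => (1 : ℝ)) (cdS i U μ Ψ) (cdS i U μ Φ))
        + ∑ z, ∑ w, avgCoeffY i z w * (Matrix.trace ((crnTrY i par U Ψ z)ᴴ * crnTrY i par U Φ w)).re := by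
  have hU' : ∀ μ x, ((U μ x : (Matrix (Fin N) (Fin N) ℂ)ˣ) : Matrix (Fin N) (Fin N) ℂ) ∈ unitary (Matrix (Fin N) (Fin N) ℂ) := fun μ x => hG (hU μ x)
  rw [deltaPrimeAY, LinearMap.add_apply, trIP_add_right]
  congr 1
  · rw [trIP_one_eq, lapSL_apply, sum_trace_mul_lapS i U hU' Ψ Φ, Complex.re_sum]
    exact Finset.sum_congr rfl fun μ _ => (trIP_one_eq _ _).symm
  · rw [trIP_one_eq, Complex.re_sum]
    refine Finset.sum_congr rfl fun z _ => ?_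
    rw [kernelTrOpY_eq_trLiftY, re_trace_conjTranspose_mul_trLiftY]
    refine Finset.sum_congr rfl fun w _ => ?_
    rw [Matrix.of_apply]
    exact avgCoeffY_mul_re_trace_eq₂ i hG par U hinv hpar Ψ Φ z w

end Bilinear

end Literature.MathematicalPhysics.QuantumFieldTheory.Balaban1983to89.B9Thm31SitePolarisedFormY
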